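import Mathlib
import HarnessLib

/-!
# Belyi polynomials and Rodriguez's prime floor for the Belyi height of a rational number

Topic `Literature/NumberTheory/DiophantineGeometry`; companion of `BelyiDegree.lean` (the Belyi
degree `deg_B(ℙ¹; 0, 1, ∞, t)` of a four-pointed line, witnessed by RATIONAL maps `p/q`).  This file
vendors the POLYNOMIAL case, where a sharp prime floor is in print with an elementary proof:
J. Rodriguez, *Bounding the degree of Belyi polynomials*, J. Number Theory 133 (2013) 2892–2900
(arXiv:1104.2027) [Rodriguez2013], read on the held arXiv text:

* Def. 1 (p. 3): "A polynomial `B(x) ∈ ℚ̄[x]` is said to be a normalized Belyi polynomial or Belyi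
  polynomial if `B(0), B(1) ∈ {0,1}` and `{B(xᵢ) : B'(xᵢ) = 0} ⊂ {0,1}`. Equivalently […]
  `B'(x) ∣ B(x)(1 − B(x))`."  The *Belyi height* `𝓗(λ)` of an algebraic number `λ` is "the minimal
  degree of normalized Belyi polynomials that map `λ` to zero or one" (p. 3).
* Thm. 3 (= Main Result, p. 8): "The Belyi height of `λ`, `𝓗(λ)`, is greater than or equal to `p`
  for `λ ≠ 0` in `ℚ̄` with non-zero `p`-adic valuation."  Followed by: "With this theorem, we know
  for every Belyi polynomial with rational number `a/b` in lowest terms as a root will have degree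
  greater than or equal to every prime `p` that divides `ab`. The well-known Belyi polynomial […]
  `B_{1,p}(x/p)` is a normalized Belyi polynomial mapping `p` to zero showing our bound is sharp."
  (Proof: Newton polygons of `B` and `B − 1` w.r.t. `p` lie on one segment when `deg B < p`,
  Thms. 1–2, so all non-zero roots of `B` and `B − 1` have the same valuation as `1`.)  As the
  author notes (p. 3), "our results follow directly from [Zapponi] and [Beckmann]": it is the
  polynomial, genus-`0` shadow of the good-reduction floor (Beckmann 1989; Zapponi, Thm. 1.3:
  `deg_B(X) ≥` greatest stable prime of bad reduction).

## Contents

* `IsBelyiPolynomial B` — Rodriguez's (normalized) Belyi polynomials, for `B : ℂ[X]` with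
  ALGEBRAIC coefficients (his `B ∈ ℚ̄[x]`, `ℚ̄ ⊂ ℂ`), of POSITIVE degree (constants are tacitly
  excluded in the source: for `B = 0` every point is critical with value `0` and Thm. 3 would fail),
  with `B(0), B(1) ∈ {0,1}` and every critical value in `{0,1}`.
* `Rodriguez2013_prime_le_natDegree` — the NAMED FACT (statement only, D-0014): Thm. 3 in its
  printed rational form — for a Belyi polynomial `B` and a rational `λ = a/b ≠ 0` in lowest terms
  with `B(λ) ∈ {0, 1}`, every prime `p ∣ ab` (i.e. `v_p(λ) ≠ 0`) satisfies `p ≤ deg B`.  Stated per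
  polynomial (this is "`𝓗(λ) ≥ p`" unfolded, with no `sInf` junk value).
* API (proved): `IsBelyiPolynomial.natDegree_pos`, `isBelyiPolynomial_X` (the identity `x` is a
  Belyi polynomial — the unit of Rodriguez's composition monoid, Ex. 3; non-vacuity), and the
  unfolding `isBelyiPolynomial_iff`.

## Relation to `BelyiDegree.lean` and to route `Summit.ABC.ABC.Theses.BelyiDegreeSmooth`

A Belyi polynomial `B` of degree `d` with `B(t) ∈ {0,1}` is a Belyi witness for `(ℙ¹; 0,1,∞,t)` in
the sense of `HasBelyiWitness d t` (take `p = B`, `q = 1`: `∞` is totally ramified, the root-count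
form of "critical values in `{0,1}`" is the Riemann–Hurwitz equality `#{roots of B(B−1)} = d + 1`);
the converse fails (most Belyi maps `ℙ¹ → ℙ¹` are not polynomials), so this file bounds the
POLYNOMIAL Belyi height, an upper bound for `belyiDegree t`, from below — it does NOT give the floor
`deg_B(ℙ¹; 0,1,∞,a/c) ≥ P(abc)` for arbitrary rational witnesses (route item `BeckmannFloor`), whose
printed forms are for curves (Zapponi 2009, Thm. 1.3, via Beckmann 1989, Prop. 5.3 / Thm. 5.5) and
for polynomials (this file).  The bridge "root-count witness with `q` constant ⇒ `IsBelyiPolynomial`"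
and the symmetry `B(x) ↦ B(1 − x)` (which turns the floor for `p ∣ ab` into one for `p ∣ (b − a)b`)
are deliberately NOT here.

## References

* [Rodriguez2013] J. Rodriguez, Bounding the degree of Belyi polynomials, J. Number Theory 133
  (2013), Def. 1, Ex. 1, Ex. 3, Thm. 3 and the remark following it, Ex. 5 (`𝓗(4) = 3`).
* [Zapponi2009BelyiDegree] L. Zapponi, On the Belyi degree(s) of a curve defined over a number
  field, arXiv:0904.0967, Thm. 1.3.
* [Beckmann1989] S. Beckmann, Ramified primes in the field of moduli of branched coverings of
  curves, J. Algebra 125 (1989), Prop. 5.3, Thm. 5.5.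
-/

namespace Literature.NumberTheory.DiophantineGeometry

open Polynomial

/-- `IsBelyiPolynomial B`: `B ∈ ℂ[X]` is a (normalized) **Belyi polynomial** in the sense of
Rodriguez 2013, Def. 1 — "A polynomial `B(x) ∈ ℚ̄[x]` is said to be a normalized Belyi polynomial or
Belyi polynomial if `B(0), B(1) ∈ {0,1}` and `{B(xᵢ) : B'(xᵢ) = 0} ⊂ {0,1}`" — rendered for a
complex polynomial with algebraic coefficients (`ℚ̄ ⊂ ℂ`) and, as tacitly in the source, of positive
degree: every coefficient is algebraic over `ℚ`, `0 < deg B`, `B(0) ∈ {0,1}`, `B(1) ∈ {0,1}`, and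
every critical point `z` (`B'(z) = 0`) has critical value `B(z) ∈ {0,1}` (so `B : ℙ¹ → ℙ¹` is
unramified outside `{0, 1, ∞}`, with `∞` totally ramified). [cite: Rodriguez2013, Def. 1] -/
def IsBelyiPolynomial (B : ℂ[X]) : Prop :=
  (∀ n, IsAlgebraic ℚ (B.coeff n)) ∧ 0 < B.natDegree ∧
    (B.eval 0 = 0 ∨ B.eval 0 = 1) ∧ (B.eval 1 = 0 ∨ B.eval 1 = 1) ∧
    ∀ z : ℂ, B.derivative.eval z = 0 → B.eval z = 0 ∨ B.eval z = 1

/-- Unfolding of `IsBelyiPolynomial` (by `Iff.rfl`). [cite: Rodriguez2013, Def. 1] -/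
theorem isBelyiPolynomial_iff (B : ℂ[X]) :
    IsBelyiPolynomial B ↔
      (∀ n, IsAlgebraic ℚ (B.coeff n)) ∧ 0 < B.natDegree ∧
        (B.eval 0 = 0 ∨ B.eval 0 = 1) ∧ (B.eval 1 = 0 ∨ B.eval 1 = 1) ∧
        ∀ z : ℂ, B.derivative.eval z = 0 → B.eval z = 0 ∨ B.eval z = 1 :=
  Iff.rfl

/-- A Belyi polynomial has positive degree (part of the definition). [cite: Rodriguez2013, Def. 1] -/
theorem IsBelyiPolynomial.natDegree_pos {B : ℂ[X]} (h : IsBelyiPolynomial B) : 0 < B.natDegree :=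
  h.2.1

/-- The identity `B(x) = x` is a Belyi polynomial (no critical points; `B(0) = 0`, `B(1) = 1`): the
unit of the composition monoid of Belyi polynomials. [cite: Rodriguez2013, Ex. 3] -/
theorem isBelyiPolynomial_X : IsBelyiPolynomial (X : ℂ[X]) := by
  refine ⟨fun n => ?_, by simp, by simp, by simp, fun z hz => ?_⟩
  · rw [coeff_X]
    split_ifs
    · exact isAlgebraic_one
    · exact isAlgebraic_zero
  · simp at hz

/-- **Rodriguez (2013), Theorem 3, for rational numbers — the prime floor for Belyi polynomials:**
"The Belyi height of `λ`, `𝓗(λ)`, is greater than or equal to `p` for `λ ≠ 0` in `ℚ̄` with non-zero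
`p`-adic valuation", whence (loc. cit.) "every Belyi polynomial with rational number `a/b` in
lowest terms as a root will have degree greater than or equal to every prime `p` that divides
`ab`".  Rendering (the height unfolded, per polynomial): for every Belyi polynomial `B`
(`IsBelyiPolynomial B`), every rational `λ = a/b` in lowest terms (`a : ℤ`, `a ≠ 0`, `b : ℕ`,
`0 < b`, `gcd(|a|, b) = 1`) with `B(λ) = 0` or `B(λ) = 1`, and every prime `p ∣ |a|·b` — exactly the
primes with `v_p(λ) ≠ 0` — one has `p ≤ deg B`.  Sharp: `B_{1,p}(x/p)` has degree `p` and root `p`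
(loc. cit.); but `𝓗(4) = 3` (Ex. 5).  Statement only: the printed proof is by Newton polygons of
`B` and `B − 1` with respect to `p` (Thms. 1–2).  POLYNOMIAL maps only — see the module docstring
for the relation with `HasBelyiWitness` / `belyiDegree` (rational maps) of `BelyiDegree.lean`.
[cite: Rodriguez2013, Thm. 3 and the remark following it] -/
def Rodriguez2013_prime_le_natDegree : Prop :=
  ∀ (B : ℂ[X]), IsBelyiPolynomial B →
    ∀ (a : ℤ) (b : ℕ), a ≠ 0 → 0 < b → Nat.Coprime a.natAbs b →
      (B.eval ((a : ℂ) / (b : ℂ)) = 0 ∨ B.eval ((a : ℂ) / (b : ℂ)) = 1) →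
        ∀ p ∈ (a.natAbs * b).primeFactors, p ≤ B.natDegree

/-- The fact specialised to a proper fraction `a/c`, `0 < a < c`, `gcd(a, c) = 1` (the shape of the
`abc`-routes): a Belyi polynomial taking the value `0` or `1` at `a/c` has degree `≥` every prime
dividing `a·c`. (The primes dividing `c − a` need the symmetry `B(x) ↦ B(1 − x)`, not set up here.)
[cite: Rodriguez2013, Thm. 3 and the remark following it] -/
theorem Rodriguez2013_prime_le_natDegree.of_lt (h : Rodriguez2013_prime_le_natDegree)
    {B : ℂ[X]} (hB : IsBelyiPolynomial B) {a c : ℕ} (ha : 0 < a) (hac : a < c)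
    (hcop : Nat.Coprime a c)
    (hroot : B.eval ((a : ℂ) / (c : ℂ)) = 0 ∨ B.eval ((a : ℂ) / (c : ℂ)) = 1) :
    ∀ p ∈ (a * c).primeFactors, p ≤ B.natDegree := by
  have h' := h B hB (a : ℤ) c (by exact_mod_cast ha.ne') (lt_trans ha hac)
    (by simpa using hcop) (by simpa using hroot)
  simpa using h'

end Literature.NumberTheory.DiophantineGeometry
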